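import Literature.Geometry.Kaehler.CyclotomicCMTypesDegreeEightHodgeConjecture
import Literature.AlgebraicGeometry.ComplexMultiplication.CyclotomicFermatCMTypesLevelTwentyFourTriples
import Literature.AlgebraicGeometry.ComplexMultiplication.SimpleIffPrimitiveCMType
import HarnessLib

/-!
# The Hodge conjecture for all powers of every SIMPLE abelian variety with complex multiplication by a cyclotomic field of
# degree `8` — in particular for the simple factor `L_{1,3,20} ⊂ ℂ⁴` of `J(F₂₄)` and its whole isogeny class

Layer `Literature/Geometry/Kaehler`, namespace `Literature.Geometry.Kaehler.ComplexTorus`; lane `lit-hodgefound` (Track 2 foundations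
library), prover seat `lit-hodgefound-p10`, generation 33, row «A2-26(hg)» (self-proposed 2026-08-28).  Theorems only; no `def`, no instance,
no named fact (net Literature debt 0).

The BRIDGE between this generation's Hodge files (`CyclotomicCMTypesDegreeEightHodgeConjecture`: every abelian variety of a PRIMITIVE CM type
of `ℚ(ζ_d)`, `φ(d) = 8`, is a simple fourfold with `B•(Aⁿ) ⊗ ℂ = D•(Aⁿ) ⊗ ℂ` and the Hodge conjecture for all powers) and the lane's
level-`24` Fermat files (`CyclotomicFermatCMTypesLevelTwentyFour(Triples)`, after Bauer–Coste–Itzykson–Ruelle §3.4: the Koblitz–Rohrlich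
factor types `H_{r,s,t}` modulo `24` are either one of four GROUPS — realisations `∼ E⁴` — or one of the four unit translates of
`H_{1,3,20} = {1,5,11,17}` containing `1` — realisations SIMPLE FOURFOLDS, one isogeny class; honest column there: «The Hodge conjecture
is not proved and nothing here bears on it»).  Simple ⟺ primitive (the tree's `isSimple_iff_isPrimitive`), so:

* **`hodgeClassSpan_pow_eq_and_hodgeConjectureFor_pow_of_isSimple_of_totient_eq_eight`**: every SIMPLE abelian variety `A` realising a CM
  type of a cyclotomic field of degree `8` has `B•(Aⁿ) ⊗ ℂ = D•(Aⁿ) ⊗ ℂ` and satisfies the Hodge conjecture with ALL its powers;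
  `hodgeConjectureFor_of_isSimple_of_totient_eq_eight`.
* `isPrimitive_cmTypeOfResidues_of_mem_translates_twentyFour` (the four translates of `H_{1,3,20}` containing `1` cut out PRIMITIVE types),
  **`isSimple_and_hodgeConjectureFor_pow_fermat_twentyFour_of_mem`** (every realisation of a non-group Koblitz–Rohrlich type at `24` is a
  simple fourfold satisfying, with all its powers, the Hodge conjecture), `hodgeConjectureFor_fermat_twentyFour_of_mem`,
  **`hodgeConjectureFor_pow_fermat_one_three_twenty`** (BCIR's `L_{1,3,20}`: the simple fourfold in `J(F₂₄) ∼ [ℂ⁴/L_{1,3,20}]^{24} ⊕ …`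
  satisfies the Hodge conjecture with all its powers), **`hodgeConjectureFor_pow_fermat_twentyFour_of_isSimple`** (every SIMPLE realisation
  of any Koblitz–Rohrlich type modulo `24`).  Aoki's condition (tree `hodgeConjectureFor_pow_fermat`, `AokiConditionSix` + «`p^i ≡ −1`») FAILS
  at `m = 24` (`3^i ≢ −1 (mod 8)`); the present route is Dodson's rank (`= 5`, nondegenerate) for the primitive types of `ℚ(ζ₂₄)`.

Honest column: `F₂₄`, `J(F₂₄)` and its decomposition are NOT constructed (as in the siblings, everything is typed on the factor TYPES and
their realisations); the `E⁴`-types (`157` elliptic triples) are not treated here on varieties (their complex tori have `Hdg = Div` on all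
powers by `ComplexTorusCyclotomicCharpolyTwentyFourHodge`).

## References

* [BauerCosteItzyksonRuelle1997] M. Bauer, A. Coste, C. Itzykson, P. Ruelle, *Comments on the links between su(3) modular invariants,
  simple factors in the Jacobian of Fermat curves, and rational triangular billiards*, J. Geom. Phys. 22 (1997), §3.4.
* [Dodson1984] B. Dodson, *The structure of Galois groups of CM-fields*, Trans. AMS 283 (1984), §3.3.2 Theorem p. 16.
* [Gordon1999HodgeAVSurvey] B. B. Gordon, *A survey of the Hodge conjecture for abelian varieties* (1999), Thm. 6.4, §9.3, §9.4.2.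
* [KoblitzRohrlich1978] N. Koblitz, D. Rohrlich, *Simple factors in the Jacobian of a Fermat curve*, Canad. J. Math. 30 (1978), §1 p. 1184.
* [Shimura1998] G. Shimura, *Abelian Varieties with Complex Multiplication and Modular Functions* (1998), §8.2 Prop. 26, §8.4.
-/

noncomputable section

open scoped Classical nonZeroDivisors NumberField
open NumberField Module CategoryTheory CategoryTheory.Limits

namespace Literature.Geometry.Kaehler

namespace ComplexTorus

-- `open scoped`: the tree's action of `Aut(ℂ)` on `Hom(K, ℂ)` by composition (`ringEquivCompAction`) is a scoped instance
open scoped Literature.NumberTheory.ComplexMultiplication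
open Literature.AlgebraicGeometry.Motives (CMType AbelianVariety)
open Literature.AlgebraicGeometry.HodgeTheory (HodgeConjectureFor complexBetti)
open Literature.AlgebraicGeometry.VanGeemen1994 (hodgeClassSpan)
open Literature.Barriers.HodgeConjecture (divisorClassesSpan)
open Literature.NumberTheory.ComplexMultiplication (IsPrimitive)
open Literature.AlgebraicGeometry.ComplexMultiplication (IsCMTypeRealisation isSimple_iff_isPrimitive)
open Literature.AlgebraicGeometry.HodgeTheory (fermatCMType)
open Literature.AlgebraicGeometry.ComplexMultiplication.CyclotomicFermatCMType (isCMResidueSet_fermatCMType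
  fermatCMType_twentyFour_one_three_twenty)
open Literature.AlgebraicGeometry.ComplexMultiplication.CyclotomicCMTypeResidueSets (IsCMResidueSet unitResidues residueSet
  HasTrivialStabilizer residueSet_cmTypeOfResidues isPrimitive_iff_hasTrivialStabilizer)
open Literature.AlgebraicGeometry.Pohlmann1968.Cyclotomic (cmTypeOfResidues)

/-! ### §1 Simple abelian varieties with complex multiplication by a cyclotomic field of degree `8` -/

section Simple

variable {d : ℕ} {K : Type} [Field K] [NumberField K]
  {A : AbelianVariety ℂ} {ι : 𝓞 K →+* End A} {θ : K →+* Module.End ℂ (complexBetti A.X 1)}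

/-- **EVERY SIMPLE ABELIAN VARIETY WITH COMPLEX MULTIPLICATION BY A CYCLOTOMIC FIELD OF DEGREE `8` HAS `B•(Aⁿ) ⊗ ℂ = D•(Aⁿ) ⊗ ℂ`
AND SATISFIES THE HODGE CONJECTURE WITH ALL ITS POWERS** (`A` realising a CM type `Φ` of `ℚ(ζ_d)`, `φ(d) = 8`; simple ⟺ `Φ`
primitive ⟺ `Φ` nondegenerate). [cite: Dodson1984, §3.3.2 Theorem (p. 16)] [cite: Gordon1999HodgeAVSurvey, Thm. 6.4 and §9.3]
[cite: Shimura1998, §8.2 Prop. 26] -/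
theorem hodgeClassSpan_pow_eq_and_hodgeConjectureFor_pow_of_isSimple_of_totient_eq_eight (hK : IsCyclotomicExtension {d} ℚ K)
    (h8 : Nat.totient d = 8) {Φ : CMType K} (hA : IsCMTypeRealisation Φ A ι θ) (hs : A.IsSimple) (n k : ℕ) :
    hodgeClassSpan (⨁ fun _ : Fin n => A).dim (⨁ fun _ : Fin n => A).X k =
        divisorClassesSpan (⨁ fun _ : Fin n => A).X (⨁ fun _ : Fin n => A).dim k ∧
      HodgeConjectureFor (⨁ fun _ : Fin n => A).dim (⨁ fun _ : Fin n => A).X := by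
  obtain ⟨φ₀⟩ : Nonempty (K →+* ℂ) := inferInstance
  have hΦ : IsPrimitive (ℂ ≃+* ℂ) Φ.1 φ₀ := (isSimple_iff_isPrimitive hA φ₀).1 hs
  exact (isSimple_and_hodgeConjectureFor_pow_of_isPrimitive_of_totient_eq_eight hK h8 Φ φ₀ hΦ hA n k).2

/-- **The Hodge conjecture for every simple abelian variety with complex multiplication by a cyclotomic field of degree `8`.**
[cite: Dodson1984, §3.3.2 Theorem (p. 16)] [cite: Gordon1999HodgeAVSurvey, Thm. 6.4 and §9.3] -/
theorem hodgeConjectureFor_of_isSimple_of_totient_eq_eight (hK : IsCyclotomicExtension {d} ℚ K) (h8 : Nat.totient d = 8)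
    {Φ : CMType K} (hA : IsCMTypeRealisation Φ A ι θ) (hs : A.IsSimple) : HodgeConjectureFor A.dim A.X := by
  obtain ⟨φ₀⟩ : Nonempty (K →+* ℂ) := inferInstance
  exact hodgeConjectureFor_of_isPrimitive_of_totient_eq_eight hK h8 Φ φ₀ ((isSimple_iff_isPrimitive hA φ₀).1 hs) hA

end Simple

/-! ### §2 The simple factors of `J(F₂₄)`: the class of `H_{1,3,20} = {1, 5, 11, 17}` -/

section Fermat

variable {L : Type} [Field L] [NumberField L] [IsCyclotomicExtension {24} ℚ L] {r s t : ZMod 24}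
  {hS : ∀ c : ZMod 24, c.val.Coprime 24 → (c ∈ fermatCMType 24 r s t ↔ -c ∉ fermatCMType 24 r s t)}
  {A : AbelianVariety ℂ} {ι : 𝓞 L →+* End A} {θ : L →+* Module.End ℂ (complexBetti A.X 1)}

/-- The four unit translates of `H_{1,3,20}` containing `1` have trivial residue stabiliser. [cite: BauerCosteItzyksonRuelle1997, §3.4] -/
private theorem hasTrivialStabilizer_of_mem_translates_twentyFour {S : Finset (ZMod 24)}
    (hH : S ∈ ({{1, 5, 11, 17}, {1, 5, 7, 13}, {1, 7, 11, 19}, {1, 13, 17, 19}} : Finset (Finset (ZMod 24)))) :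
    HasTrivialStabilizer 24 S := by
  simp only [Finset.mem_insert, Finset.mem_singleton] at hH
  rcases hH with rfl | rfl | rfl | rfl <;> decide

/-- **The CM types of `ℚ(ζ₂₄)` cut out by the translates of `H_{1,3,20}` are PRIMITIVE** (`W = {1}`, Shimura §8.2 Prop. 26 read on
residues). [cite: BauerCosteItzyksonRuelle1997, §3.4] [cite: Shimura1998, §8.2 Prop. 26, §8.4 Example (1)] -/
theorem isPrimitive_cmTypeOfResidues_of_mem_translates_twentyFour {S : Finset (ZMod 24)}
    {hS : ∀ c : ZMod 24, c.val.Coprime 24 → (c ∈ S ↔ -c ∉ S)} (hcm : IsCMResidueSet 24 S)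
    (hH : S ∈ ({{1, 5, 11, 17}, {1, 5, 7, 13}, {1, 7, 11, 19}, {1, 13, 17, 19}} : Finset (Finset (ZMod 24)))) (φ₀ : L →+* ℂ) :
    IsPrimitive (ℂ ≃+* ℂ) (cmTypeOfResidues (L := L) S hS).1 φ₀ := by
  rw [isPrimitive_iff_hasTrivialStabilizer 24, residueSet_cmTypeOfResidues 24 hcm]
  exact hasTrivialStabilizer_of_mem_translates_twentyFour hH

/-- **EVERY REALISATION OF A NON-GROUP KOBLITZ–ROHRLICH TYPE AT `24` IS A SIMPLE FOURFOLD WITH `B•(Aⁿ) ⊗ ℂ = D•(Aⁿ) ⊗ ℂ` AND THE HODGE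
CONJECTURE FOR ALL ITS POWERS** (`H_{r,s,t}` one of the four translates of `H_{1,3,20}` containing `1`: the `24 · 4` non-group triples).
[cite: BauerCosteItzyksonRuelle1997, §3.4] [cite: Dodson1984, §3.3.2 Theorem (p. 16)] [cite: Gordon1999HodgeAVSurvey, Thm. 6.4 and §9.3] -/
theorem isSimple_and_hodgeConjectureFor_pow_fermat_twentyFour_of_mem
    (hH : fermatCMType 24 r s t ∈ ({{1, 5, 11, 17}, {1, 5, 7, 13}, {1, 7, 11, 19}, {1, 13, 17, 19}} : Finset (Finset (ZMod 24))))
    (hA : IsCMTypeRealisation (cmTypeOfResidues (L := L) (fermatCMType 24 r s t) hS) A ι θ) (n k : ℕ) :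
    A.IsSimple ∧
      hodgeClassSpan (⨁ fun _ : Fin n => A).dim (⨁ fun _ : Fin n => A).X k =
        divisorClassesSpan (⨁ fun _ : Fin n => A).X (⨁ fun _ : Fin n => A).dim k ∧
      HodgeConjectureFor (⨁ fun _ : Fin n => A).dim (⨁ fun _ : Fin n => A).X := by
  obtain ⟨φ₀⟩ : Nonempty (L →+* ℂ) := inferInstance
  exact isSimple_and_hodgeConjectureFor_pow_of_isPrimitive_twentyFour inferInstance _ φ₀
    (isPrimitive_cmTypeOfResidues_of_mem_translates_twentyFour (isCMResidueSet_fermatCMType hS) hH φ₀) hA n k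

/-- **The Hodge conjecture for every realisation of a non-group Koblitz–Rohrlich type at `24`** (`HodgeConjectureFor A.dim A.X`, `dim A = 4`).
[cite: BauerCosteItzyksonRuelle1997, §3.4] [cite: Dodson1984, §3.3.2 Theorem (p. 16)] -/
theorem hodgeConjectureFor_fermat_twentyFour_of_mem
    (hH : fermatCMType 24 r s t ∈ ({{1, 5, 11, 17}, {1, 5, 7, 13}, {1, 7, 11, 19}, {1, 13, 17, 19}} : Finset (Finset (ZMod 24))))
    (hA : IsCMTypeRealisation (cmTypeOfResidues (L := L) (fermatCMType 24 r s t) hS) A ι θ) : HodgeConjectureFor A.dim A.X := by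
  obtain ⟨φ₀⟩ : Nonempty (L →+* ℂ) := inferInstance
  exact hodgeConjectureFor_of_isPrimitive_twentyFour inferInstance _ φ₀
    (isPrimitive_cmTypeOfResidues_of_mem_translates_twentyFour (isCMResidueSet_fermatCMType hS) hH φ₀) hA

/-- **BCIR's `L_{1,3,20} ⊂ ℂ⁴` — THE SIMPLE FOURFOLD OF `J(F₂₄) ∼ [ℂ⁴/L_{1,3,20}]^{24} ⊕ [157 elliptic curves]` — SATISFIES THE HODGE CONJECTURE
WITH ALL ITS POWERS**: every realisation `A₀` of `Φ_{H_{1,3,20}}`, `H_{1,3,20} = {1,5,11,17}`, is a simple fourfold with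
`HodgeConjectureFor (A₀ⁿ)` for every `n`. [cite: BauerCosteItzyksonRuelle1997, §3.4] [cite: Dodson1984, §3.3.2 Theorem (p. 16)]
[cite: Gordon1999HodgeAVSurvey, Thm. 6.4 and §9.3] -/
theorem hodgeConjectureFor_pow_fermat_one_three_twenty
    {hS₀ : ∀ c : ZMod 24, c.val.Coprime 24 → (c ∈ fermatCMType 24 1 3 20 ↔ -c ∉ fermatCMType 24 1 3 20)}
    {A₀ : AbelianVariety ℂ} {ι₀ : 𝓞 L →+* End A₀} {θ₀ : L →+* Module.End ℂ (complexBetti A₀.X 1)}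
    (hA₀ : IsCMTypeRealisation (cmTypeOfResidues (L := L) (fermatCMType 24 1 3 20) hS₀) A₀ ι₀ θ₀) (n : ℕ) :
    A₀.IsSimple ∧ A₀.dim = 4 ∧ HodgeConjectureFor (⨁ fun _ : Fin n => A₀).dim (⨁ fun _ : Fin n => A₀).X := by
  have hH : fermatCMType 24 1 3 20 ∈ ({{1, 5, 11, 17}, {1, 5, 7, 13}, {1, 7, 11, 19}, {1, 13, 17, 19}} : Finset (Finset (ZMod 24))) := by
    rw [fermatCMType_twentyFour_one_three_twenty]; decide
  have h := isSimple_and_hodgeConjectureFor_pow_fermat_twentyFour_of_mem hH hA₀ n 0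
  exact ⟨h.1, dim_eq_four_of_isCMTypeRealisation_twentyFour inferInstance hA₀, h.2.2⟩

/-- **EVERY SIMPLE REALISATION OF ANY KOBLITZ–ROHRLICH TYPE MODULO `24` SATISFIES THE HODGE CONJECTURE WITH ALL ITS POWERS** (the simple
factors of `J(F₂₄)` with complex multiplication by the whole of `ℚ(ζ₂₄)`). [cite: BauerCosteItzyksonRuelle1997, §3.4]
[cite: Dodson1984, §3.3.2 Theorem (p. 16)] [cite: Gordon1999HodgeAVSurvey, Thm. 6.4 and §9.3] -/
theorem hodgeConjectureFor_pow_fermat_twentyFour_of_isSimple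
    (hA : IsCMTypeRealisation (cmTypeOfResidues (L := L) (fermatCMType 24 r s t) hS) A ι θ) (hs : A.IsSimple) (n : ℕ) :
    HodgeConjectureFor (⨁ fun _ : Fin n => A).dim (⨁ fun _ : Fin n => A).X :=
  (hodgeClassSpan_pow_eq_and_hodgeConjectureFor_pow_of_isSimple_of_totient_eq_eight (d := 24) inferInstance (by decide) hA hs n 0).2

end Fermat

end ComplexTorus

end Literature.Geometry.Kaehler

end
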